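import Summits.Ventures.CertifiedManyBodySolver.Certificates.EmeryCu4O8_kry_SLCO_c2lh_s10x10_S0
import HarnessLib

/-!
# KLDL-R certificate: an exact cluster vector of the open `Cu₄O₈` block (SLCO three-band corner `c2lh`, sector `(10,10)`, `N = 20`) — part S2 (kernel traces of atom classes [2, 4, 7])

HONEST FRAMING: certified energy-window bookkeeping (a hypothesis-free UPPER bound on the three-band ground-state energy density at
`ρ = 20/16` from ONE explicit cluster vector, Ruelle's cluster variational principle as typed in `EmeryThreeBandBlock2x2RayleighCap`);
not a superconductivity verdict; no number of record at an anchor moves. WHAT-THIS-IS-NOT: a floor; a phase word.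

The vector: the integer-rounded (scale `2^16`) lowest eigenvector of `h(θ) = Σ_a θ_a h^G_a` (`h^G_a = hubbardOpenBoxGP 1 12 (cu4o8Tau a) (cu4o8Ups a) (cu4o8Nu a)`)
on the spin sector `(10,10)` of the twelve physical sites of the open `2×2`-cell block (dimension 4356; 4226 nonzero coefficients), at the coupling vector
`θ = ['129/100', '129/100', '129/100', '129/100', '-41/50', '-41/50', '-41/50', '-41/50', '21/10', '0', '0', '222/25', '144/25', '144/25']` (SLCO corner `c2lh` of `BLOCK-TABLES-La214v123_v1` = (t_pd ×4, −t_pp ×4, Δ_pd, ε_px, ε_py, U_d, U_px, U_py), cuprate signs),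
stored as a `CoefTree` (search tree over occupation codes, `HubbardOpenBoxCodedRayleigh`). Norm `NN = 4294959934`; the fourteen EXACT integer traces
`S_a = NN·⟨unit, h^G_a unit⟩ = [-7962354264, -4062998608, -7962354264, -4062998608, 1405414660, 2478991616, 795521504, 1405414660, 20381919444, 32758639618, 32758639618, 3279886384, 15603578178, 15603578178]` (float eigenvalue 50.213563697 eV/cluster; exact Rayleigh quotient 50.213565350; cap 3.1383478 eV/site = 12.553391 eV/CuO₂).
Parts: S0 = the tree + search-tree order / norm / particle number (kernel); S1–S3 = the fourteen traces `CoefTree.sApp` over the hop-list oracles `cu4o8ClusterF a` (kernel, `decide +kernel`);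
F = the assembled table and the consequences (`emeryEnergyDensity_le_of_cu4o8Tree`: for EVERY `θ'`, `e_Emery(θ', 20/16) ≤ (1/16)·Σ_a θ'_a·S_a/NN`; the corner number; the `hT` trace rows,
unit norm and particle number for the `T > 0` Rayleigh-family floor `le_emeryCellPressure_of_rayleighFamily` / `Downfold/EmeryThermalSeam`).
Generator: HOME/hubbard-box-p2/code/rayleigh/ (kit job ray_main.py: scipy eigsh + exact integer forms; emit_kry.py), hubbard-box-p2 g15.
[cite: Ruelle1969, §3.3] [cite: Emery1987, eq. (1)] [cite: LinGubernatis1993, §II]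
-/

noncomputable section

namespace Summit.Ventures.CertifiedManyBodySolver.Certificates

open Matrix Literature.MathematicalPhysics.QuantumLattice OccupationCode OccupationCode.CoefTree ClusterLowerBound InfVolFermionState HubbardWave0

/-- The exact trace of atom class `2` (kernel). [cite: Ruelle1969, §3.3] -/
theorem kry_SLCO_c2lh_s10x10_sApp2 : kry_SLCO_c2lh_s10x10.sApp (cu4o8ClusterF 2) = -7962354264 := by decide +kernel

/-- The exact trace of atom class `4` (kernel). [cite: Ruelle1969, §3.3] -/
theorem kry_SLCO_c2lh_s10x10_sApp4 : kry_SLCO_c2lh_s10x10.sApp (cu4o8ClusterF 4) = 1405414660 := by decide +kernel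

/-- The exact trace of atom class `7` (kernel). [cite: Ruelle1969, §3.3] -/
theorem kry_SLCO_c2lh_s10x10_sApp7 : kry_SLCO_c2lh_s10x10.sApp (cu4o8ClusterF 7) = 1405414660 := by decide +kernel

end Summit.Ventures.CertifiedManyBodySolver.Certificates

end
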